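import Summits.Ventures.LatticeQCDFlow.TrivializingMaps.AbelianTail

/-!
HONEST FRAMING: exact (Metropolis-corrected) sampling algorithms for lattice gauge theory; figures of
merit are autocorrelation/cost numbers at stated couplings and volumes; no continuum-physics claim.

# AbelianDictionary — the Fourier-side recursion `stepR`/`luscherCoeffs` IS Lüscher's recursion (4.12)–(4.15)
for `G = U(1)` and the Wilson action; THEOREM A on the FUNCTION side (THEORY-1.md §12.4 dictionary, §12.13; row R-T1-13)

Proposed tree path: `Summits/Ventures/LatticeQCDFlow/TrivializingMaps/AbelianDictionary.lean` (OURS). Imports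
`AbelianTail.lean` (end of the chain; the generic part needs only `AbelianRadius.lean`). Function side on the
link angles `θ ∈ ℝ^E` (`U_e = e^{iθ_e}`): `ev a θ = ∑_m a_m cos(m·θ)`; `pd e` = `∂/∂θ_e` (a `deriv`); Lüscher's
positive Laplacian `lapL = -∑_e ∂_e∂_e`; the Wilson action `S1 = ∑_p (1 - cos(χ_p·θ))` (β factored into the
flow time); his first-order operator `V f = ∑_e ∂_e S1 · ∂_e f`. PROVED: `pd_ev` (the gradient formula bounded by
`locNorm`), `lapL_ev` (modes are `Δ`-eigenfunctions with eigenvalue `c(m) = ∑ m_e²`), `V_ev` (product-to-sum),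
`lapL_ev_stepR : ∃ C, ∀ θ, Δ(ev (stepR K a)) θ = -V (ev a) θ + C` = eq. (4.13), `stepR_apply_zero` (no constant
mode), `lapL_ev_luscherCoeffs_zero` (eq. (4.12), needs `c(χ_p) = 4`), and on the torus `Torus.normSq_bdry`
(`L ≥ 2`), `Torus.lapL_ev_luscherCoeffs_zero/succ`, and the function-side THEOREM A
`Torus.abs_pd_luscher_le : L ≥ 4 → |∂_e s_k(θ)| ≤ ((d-1)/2)(6(d-1))^k`. [cite: Luscher2010Trivializing, Commun.
Math. Phys. 293 (2010) 899, arXiv:0907.5491, §4.3 (4.12)–(4.15)]. 0 sorries, axioms {propext, Classical.choice,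
Quot.sound}. Cell `lqcd-flow`, unit `pub-lqcd-theory1-g3`, 2026-08-21.
-/

namespace Summit.Ventures.LatticeQCDFlow.TrivializingMaps.Abelian

open Finset

variable {E P : Type*} [Fintype E] [Fintype P]

noncomputable section

/-! ## The DICTIONARY (R-T1-13): `stepR` / `luscherCoeffs` are the Fourier side of Lüscher's recursion
(4.12)–(4.15) for G = U(1) and the Wilson action — `Δ S̃⁽⁰⁾ = S + Ċ⁽⁰⁾`, `Δ S̃⁽ᵏ⁾ = -∑_e ∂_e S · ∂_e S̃⁽ᵏ⁻¹⁾ + Ċ⁽ᵏ⁾`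
with Lüscher's POSITIVE Laplacian `Δ = -∑_e ∂_e ∂_e` [cite: Luscher2010Trivializing §4.3 (4.12)–(4.15)]. -/

section Dictionary

variable [DecidableEq E]

/-- The phase `m·θ = ∑_e m_e θ_e` of the Fourier mode `m ∈ ℤ^E` at the link-angle configuration `θ`. -/
def phase (m : Mode E) (θ : E → ℝ) : ℝ := ∑ e, (m e : ℝ) * θ e

omit [DecidableEq E] in
/-- `phase` is additive in the mode. -/
theorem phase_add (m n : Mode E) (θ : E → ℝ) : phase (m + n) θ = phase m θ + phase n θ := by
  simp only [phase, Pi.add_apply, Int.cast_add, add_mul, Finset.sum_add_distrib]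

omit [DecidableEq E] in
/-- `phase` of a difference. -/
theorem phase_sub (m n : Mode E) (θ : E → ℝ) : phase (m - n) θ = phase m θ - phase n θ := by
  simp only [phase, Pi.sub_apply, Int.cast_sub, sub_mul, Finset.sum_sub_distrib]

omit [DecidableEq E] in
/-- The zero mode has phase `0`. -/
theorem phase_zero (θ : E → ℝ) : phase (0 : Mode E) θ = 0 := by
  simp [phase]

/-- Moving one link angle moves the phase linearly with slope `m_e`. -/
theorem phase_update (m : Mode E) (θ : E → ℝ) (e : E) (s : ℝ) :
    phase m (Function.update θ e s) = phase m θ + (m e : ℝ) * (s - θ e) := by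
  have h : ∀ e', (m e' : ℝ) * Function.update θ e s e' =
      (m e' : ℝ) * θ e' + (if e' = e then (m e : ℝ) * (s - θ e) else 0) := by
    intro e'
    by_cases he : e' = e
    · subst he
      simp only [Function.update_self, if_true]
      ring
    · simp only [Function.update_of_ne he, he, if_false, add_zero]
  simp only [phase, h, Finset.sum_add_distrib, Finset.sum_ite_eq' Finset.univ e, Finset.mem_univ,
    if_true]

/-- Weighted trigonometric polynomial with coefficient family `a`, as a LINEAR functional of `a`:
`a ↦ ∑_m a_m · w(m) · g(m·θ)`. -/
def trig (w : Mode E → ℝ) (g : ℝ → ℝ) (θ : E → ℝ) : Coeffs E →ₗ[ℝ] ℝ :=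
  Finsupp.linearCombination ℝ fun m => w m * g (phase m θ)

omit [DecidableEq E] in
/-- `trig` as an explicit finite sum. -/
theorem trig_apply (w : Mode E → ℝ) (g : ℝ → ℝ) (θ : E → ℝ) (a : Coeffs E) :
    trig w g θ a = a.sum fun m am => am * (w m * g (phase m θ)) := by
  simp [trig, Finsupp.linearCombination_apply, smul_eq_mul]

omit [DecidableEq E] in
/-- `trig` on a single mode. -/
theorem trig_single (w : Mode E → ℝ) (g : ℝ → ℝ) (θ : E → ℝ) (m : Mode E) (r : ℝ) :
    trig w g θ (Finsupp.single m r) = r * (w m * g (phase m θ)) := by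
  simp [trig, Finsupp.linearCombination_single, smul_eq_mul]

/-- THE FUNCTION SIDE: the real trigonometric polynomial `θ ↦ ∑_m a_m cos(m·θ)` on the link angles
`θ ∈ ℝ^E` (i.e. on `U(1)^E`, `U_e = e^{iθ_e}`). -/
def ev (a : Coeffs E) (θ : E → ℝ) : ℝ := trig (fun _ => 1) Real.cos θ a

/-- The partial derivative in the link angle `θ_e` (the left-invariant vector field on the `e`-th `U(1)`). -/
def pd (e : E) (f : (E → ℝ) → ℝ) (θ : E → ℝ) : ℝ :=
  deriv (fun s => f (Function.update θ e s)) (θ e)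

/-- Lüscher's (positive) Laplacian on `U(1)^E`: `Δ = -∑_e ∂_e ∂_e`. -/
def lapL (f : (E → ℝ) → ℝ) (θ : E → ℝ) : ℝ := -∑ e, pd e (pd e f) θ

/-- The U(1) Wilson plaquette action with `β` factored into the flow time: `S(θ) = ∑_p (1 - cos(χ_p·θ))`. -/
def S1 (K : PlaquetteComplex E P) (θ : E → ℝ) : ℝ := ∑ p, (1 - Real.cos (phase (K.χ p) θ))

/-- Lüscher's first-order operator `f ↦ ∑_e ∂_e S · ∂_e f` (the `t`-coefficient of `𝓛_t`, (4.5)). -/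
def V (K : PlaquetteComplex E P) (f : (E → ℝ) → ℝ) (θ : E → ℝ) : ℝ := ∑ e, pd e (S1 K) θ * pd e f θ

/-- Chain rule through the phase. -/
theorem hasDerivAt_comp_phase {g g' : ℝ → ℝ} (hg : ∀ x, HasDerivAt g (g' x) x) (m : Mode E)
    (θ : E → ℝ) (e : E) :
    HasDerivAt (fun s => g (phase m (Function.update θ e s))) (g' (phase m θ) * (m e : ℝ)) (θ e) := by
  have hfun : (fun s => g (phase m (Function.update θ e s))) =
      fun s => g (phase m θ + (m e : ℝ) * (s - θ e)) := funext fun s => by rw [phase_update]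
  rw [hfun]
  have hin : HasDerivAt (fun s => phase m θ + (m e : ℝ) * (s - θ e)) ((m e : ℝ) * 1) (θ e) :=
    (((hasDerivAt_id (θ e)).sub_const (θ e)).const_mul _).const_add _
  have h := (hg (phase m θ + (m e : ℝ) * (θ e - θ e))).comp (θ e) hin
  simp only [sub_self, mul_zero, add_zero, mul_one] at h
  exact h

/-- Differentiating a weighted trigonometric polynomial in `θ_e` multiplies the weight by `m_e` and
differentiates the profile. -/
theorem hasDerivAt_trig {g g' : ℝ → ℝ} (hg : ∀ x, HasDerivAt g (g' x) x) (w : Mode E → ℝ)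
    (a : Coeffs E) (θ : E → ℝ) (e : E) :
    HasDerivAt (fun s => trig w g (Function.update θ e s) a)
      (trig (fun m => w m * (m e : ℝ)) g' θ a) (θ e) := by
  simp only [trig_apply, Finsupp.sum]
  refine HasDerivAt.fun_sum fun m _ => ?_
  have h := ((hasDerivAt_comp_phase hg m θ e).const_mul (w m)).const_mul (a m)
  exact h.congr_deriv (by ring)

/-- `∂_e` of a weighted trigonometric polynomial, as a `deriv`. -/
theorem pd_trig {g g' : ℝ → ℝ} (hg : ∀ x, HasDerivAt g (g' x) x) (w : Mode E → ℝ) (a : Coeffs E)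
    (θ : E → ℝ) (e : E) :
    pd e (fun θ => trig w g θ a) θ = trig (fun m => w m * (m e : ℝ)) g' θ a :=
  (hasDerivAt_trig hg w a θ e).deriv

/-- **Dictionary, gradient.** `∂_e (∑_m a_m cos(m·θ)) = ∑_m -(a_m m_e sin(m·θ))` — EXACTLY the formula
bounded by `abs_gradFormula_le_locNorm`; so `locNorm e a` bounds the true link derivative of `ev a`. -/
theorem pd_ev (a : Coeffs E) (θ : E → ℝ) (e : E) :
    pd e (ev a) θ = a.sum fun m am => -(am * (m e : ℝ) * Real.sin (phase m θ)) := by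
  have h := pd_trig (g := Real.cos) (g' := fun x => -Real.sin x) Real.hasDerivAt_cos
    (fun _ => (1 : ℝ)) a θ e
  change pd e (fun θ => trig (fun _ => (1 : ℝ)) Real.cos θ a) θ = _
  rw [h, trig_apply]
  exact Finset.sum_congr rfl fun m _ => by ring

/-- `|∂_e (ev a)(θ)| ≤ N_e(a)` at every configuration. -/
theorem abs_pd_ev_le_locNorm (a : Coeffs E) (θ : E → ℝ) (e : E) : |pd e (ev a) θ| ≤ locNorm e a := by
  rw [pd_ev]
  exact abs_gradFormula_le_locNorm e a fun m => phase m θ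

/-- Second link derivative. -/
theorem pd_pd_ev (a : Coeffs E) (θ : E → ℝ) (e : E) :
    pd e (pd e (ev a)) θ = a.sum fun m am => -(am * (m e : ℝ) ^ 2 * Real.cos (phase m θ)) := by
  have h1 : pd e (ev a) = fun θ => trig (fun m => 1 * (m e : ℝ)) (fun x => -Real.sin x) θ a :=
    funext fun θ => pd_trig (g := Real.cos) (g' := fun x => -Real.sin x) Real.hasDerivAt_cos _ a θ e
  rw [h1, pd_trig (g := fun x => -Real.sin x) (g' := fun x => -Real.cos x)
    (fun x => (Real.hasDerivAt_sin x).neg), trig_apply]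
  exact Finset.sum_congr rfl fun m _ => by ring

/-- **Dictionary, Laplacian.** `Δ (∑_m a_m cos(m·θ)) = ∑_m a_m c(m) cos(m·θ)` with `c(m) = ∑_e m_e²`:
the Fourier modes are eigenfunctions of Lüscher's `Δ` with eigenvalue `c(m)` ("the eigenfunctions of `Δ`
are products of G representation functions of the link variables", §4.3). -/
theorem lapL_ev (a : Coeffs E) (θ : E → ℝ) :
    lapL (ev a) θ = trig (fun m => (normSq m : ℝ)) Real.cos θ a := by
  simp only [lapL, pd_pd_ev, trig_apply, Finsupp.sum, Finset.sum_neg_distrib, neg_neg]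
  rw [Finset.sum_comm]
  refine Finset.sum_congr rfl fun m _ => ?_
  simp only [normSq, Int.cast_sum, Int.cast_pow, Finset.sum_mul, Finset.mul_sum]
  exact Finset.sum_congr rfl fun e _ => by ring

/-- Link derivative of the Wilson action: `∂_e S = ∑_p χ_p(e) sin(χ_p·θ)`. -/
theorem pd_S1 (K : PlaquetteComplex E P) (θ : E → ℝ) (e : E) :
    pd e (S1 K) θ = ∑ p, Real.sin (phase (K.χ p) θ) * (K.χ p e : ℝ) := by
  unfold pd S1
  apply HasDerivAt.deriv
  refine HasDerivAt.fun_sum fun p _ => ?_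
  have h := (hasDerivAt_comp_phase (g := Real.cos) (g' := fun x => -Real.sin x) Real.hasDerivAt_cos
    (K.χ p) θ e).const_sub 1
  convert h using 1
  ring

omit [DecidableEq E] in
/-- Product-to-sum: `cos(x+y) - cos(x-y) = -2 sin x sin y`. -/
theorem cos_add_sub_cos_sub (x y : ℝ) :
    Real.cos (x + y) - Real.cos (x - y) = -(2 * Real.sin x * Real.sin y) := by
  rw [sub_eq_add_neg x y, Real.cos_add, Real.cos_add, Real.cos_neg, Real.sin_neg]
  ring

omit [DecidableEq E] in
/-- Reordering a triple sum `(a,b,c) ↦ (c,b,a)`. -/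
theorem sum_comm₃ {α β γ : Type*} [Fintype α] [Fintype β] (s : Finset γ) (f : α → β → γ → ℝ) :
    ∑ a, ∑ b, ∑ c ∈ s, f a b c = ∑ c ∈ s, ∑ b, ∑ a, f a b c :=
  calc ∑ a, ∑ b, ∑ c ∈ s, f a b c = ∑ a, ∑ c ∈ s, ∑ b, f a b c :=
        Finset.sum_congr rfl fun _ _ => Finset.sum_comm
    _ = ∑ c ∈ s, ∑ a, ∑ b, f a b c := Finset.sum_comm
    _ = ∑ c ∈ s, ∑ b, ∑ a, f a b c := Finset.sum_congr rfl fun _ _ => Finset.sum_comm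

/-- **Dictionary, the first-order operator.** `∑_e ∂_e S · ∂_e (∑_n a_n cos(n·θ))
= ∑_n ∑_p (⟨χ_p,n⟩ a_n / 2) (cos((n+χ_p)·θ) - cos((n-χ_p)·θ))` (product-to-sum). -/
theorem V_ev (K : PlaquetteComplex E P) (a : Coeffs E) (θ : E → ℝ) :
    V K (ev a) θ = a.sum fun n an => ∑ p, (pair (K.χ p) n : ℝ) * an / 2 *
      (Real.cos (phase (n + K.χ p) θ) - Real.cos (phase (n - K.χ p) θ)) := by
  simp only [V, pd_S1, pd_ev, Finsupp.sum, Finset.sum_mul_sum]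
  rw [sum_comm₃]
  refine Finset.sum_congr rfl fun n _ => ?_
  refine Finset.sum_congr rfl fun p _ => ?_
  rw [phase_add, phase_sub, cos_add_sub_cos_sub]
  simp only [pair, Int.cast_sum, Int.cast_mul, Finset.sum_mul, Finset.sum_div]
  exact Finset.sum_congr rfl fun e _ => by ring

omit [DecidableEq E] in
/-- `c(m)⁻¹ · c(m) · cos(m·θ) = cos(m·θ) + (ι(m) - 1)` with `ι(m) = c(m)⁻¹c(m) ∈ {0,1}`: for `m ≠ 0` both
corrections vanish, for `m = 0` the left side is `0` and `cos 0 = 1`. This is how `(0:ℝ)⁻¹ = 0` in `stepR`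
implements Lüscher's removal of the constant mode. -/
theorem inv_mul_normSq_cos (m : Mode E) (θ : E → ℝ) :
    (normSq m : ℝ)⁻¹ * ((normSq m : ℝ) * Real.cos (phase m θ)) =
      Real.cos (phase m θ) + ((normSq m : ℝ)⁻¹ * (normSq m : ℝ) - 1) := by
  by_cases hm : m = 0
  · subst hm
    simp [normSq, phase_zero]
  · have hne : (normSq m : ℝ) ≠ 0 := by
      exact_mod_cast fun h => hm ((normSq_eq_zero_iff m).1 h)
    rw [inv_mul_cancel_left₀ hne, inv_mul_cancel₀ hne, sub_self, add_zero]

/-- **DICTIONARY THEOREM, step `k → k+1` (OURS).** For every coefficient family `a`, the trigonometric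
polynomial of `stepR K a` solves Lüscher's equation (4.13) with source `ev a`:
`Δ (ev (stepR K a)) = -∑_e ∂_e S · ∂_e (ev a) + Ċ` for a constant `Ċ`, where `Δ = -∑_e ∂_e²` and
`S = ∑_p (1 - cos(χ_p·θ))`; and `stepR K a` has no constant mode (`stepR_apply_zero`), which is the
normalisation "up to an irrelevant additive constant" of §4.3. -/
theorem lapL_ev_stepR (K : PlaquetteComplex E P) (a : Coeffs E) :
    ∃ C : ℝ, ∀ θ : E → ℝ, lapL (ev (stepR K a)) θ = -V K (ev a) θ + C := by
  refine ⟨a.sum fun n an => ∑ p, (pair (K.χ p) n : ℝ) * an / 2 *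
      (((normSq (n - K.χ p) : ℝ)⁻¹ * (normSq (n - K.χ p) : ℝ) - 1) -
        ((normSq (n + K.χ p) : ℝ)⁻¹ * (normSq (n + K.χ p) : ℝ) - 1)), fun θ => ?_⟩
  have hterm : ∀ (n : Mode E) (an : ℝ) (p : P),
      (pair (K.χ p) n : ℝ) * an / 2 *
          ((normSq (n - K.χ p) : ℝ)⁻¹ * ((normSq (n - K.χ p) : ℝ) * Real.cos (phase (n - K.χ p) θ)) -
            (normSq (n + K.χ p) : ℝ)⁻¹ * ((normSq (n + K.χ p) : ℝ) * Real.cos (phase (n + K.χ p) θ))) =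
        -((pair (K.χ p) n : ℝ) * an / 2 *
            (Real.cos (phase (n + K.χ p) θ) - Real.cos (phase (n - K.χ p) θ))) +
          (pair (K.χ p) n : ℝ) * an / 2 *
            (((normSq (n - K.χ p) : ℝ)⁻¹ * (normSq (n - K.χ p) : ℝ) - 1) -
              ((normSq (n + K.χ p) : ℝ)⁻¹ * (normSq (n + K.χ p) : ℝ) - 1)) := by
    intro n an p
    rw [inv_mul_normSq_cos, inv_mul_normSq_cos]
    ring
  rw [lapL_ev, V_ev, stepR]
  simp only [Finsupp.sum, map_sum, map_smul, map_sub, smul_eq_mul, trig_single, hterm,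
    Finset.sum_add_distrib, Finset.sum_neg_distrib]

omit [DecidableEq E] in
/-- `stepR K a` has no constant Fourier mode. -/
theorem stepR_apply_zero (K : PlaquetteComplex E P) (a : Coeffs E) : stepR K a 0 = 0 := by
  simp only [stepR, Finsupp.sum, Finsupp.coe_finsetSum, Finsupp.coe_smul, Finsupp.coe_sub,
    Finset.sum_apply, Pi.smul_apply, Pi.sub_apply, smul_eq_mul]
  refine Finset.sum_eq_zero fun n _ => Finset.sum_eq_zero fun p _ => ?_
  have h0 : ∀ m : Mode E, Finsupp.single m ((normSq m : ℝ)⁻¹) (0 : Mode E) = 0 := by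
    intro m
    by_cases hm : m = 0
    · subst hm
      simp [normSq]
    · rw [Finsupp.single_eq_of_ne (Ne.symm hm)]
  rw [h0, h0, sub_self, mul_zero]

/-- **DICTIONARY THEOREM, order 0 (OURS).** If every plaquette has exactly four links (`c(χ_p) = 4`, as on
the torus with `L ≥ 2`), then `ev (luscherCoeffs K 0) = -(1/4)∑_p cos(χ_p·θ)` solves Lüscher's (4.12):
`Δ S̃⁽⁰⁾ = S + Ċ⁽⁰⁾` with `S = ∑_p (1 - cos(χ_p·θ))`. -/
theorem lapL_ev_luscherCoeffs_zero (K : PlaquetteComplex E P) (hχ : ∀ p, normSq (K.χ p) = 4) :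
    ∃ C : ℝ, ∀ θ : E → ℝ, lapL (ev (luscherCoeffs K 0)) θ = S1 K θ + C := by
  refine ⟨-(Fintype.card P : ℝ), fun θ => ?_⟩
  rw [lapL_ev, luscherCoeffs]
  simp only [map_sum, map_smul, map_add, smul_eq_mul, trig_single, S1]
  have hneg : ∀ p, normSq (-K.χ p) = normSq (K.χ p) := fun p => by simp [normSq]
  have hph : ∀ p, phase (-K.χ p) θ = -phase (K.χ p) θ := fun p => by
    have := phase_sub 0 (K.χ p) θ
    simpa [phase_zero] using this
  simp only [hneg, hχ, hph, Real.cos_neg, Finset.sum_sub_distrib, Finset.sum_const, Finset.card_univ,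
    nsmul_eq_mul, mul_one]
  push_cast
  have : ∀ p, (-(1 / 8 : ℝ)) * (1 * ((4 : ℝ) * Real.cos (phase (K.χ p) θ)) +
      1 * ((4 : ℝ) * Real.cos (phase (K.χ p) θ))) = -Real.cos (phase (K.χ p) θ) := fun p => by ring
  simp only [this, Finset.sum_neg_distrib]
  ring

/-- **DICTIONARY, all orders (OURS).** With `s_k := ev (luscherCoeffs K k)`: for every `k` there is a
constant `Ċ` with `Δ s_{k+1} = -∑_e ∂_e S · ∂_e s_k + Ċ` — Lüscher's recursion (4.13) for `G = U(1)`,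
`S = ∑_p (1 - cos θ_p)` — so `Torus.locNorm_luscherCoeffs_le_sharp` and `abs_pd_ev_le_locNorm` bound the
link gradients `∂_e S̃⁽ᵏ⁾` of LÜSCHER's functionals (normalised to `β = 1`, i.e. in the variable `tβ`). -/
theorem lapL_ev_luscherCoeffs_succ (K : PlaquetteComplex E P) (k : ℕ) :
    ∃ C : ℝ, ∀ θ : E → ℝ,
      lapL (ev (luscherCoeffs K (k + 1))) θ = -V K (ev (luscherCoeffs K k)) θ + C :=
  lapL_ev_stepR K (luscherCoeffs K k)

end Dictionary

end

noncomputable section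

namespace Torus

variable {d L : ℕ}

/-! ## The dictionary on the torus: `c(χ_p) = 4` for `L ≥ 2`, hence the full recursion (4.12)–(4.13) -/

section TorusDictionary

variable [NeZero L]

/-- On `(ℤ/L)^d` with `L ≥ 2` the four links of a plaquette are distinct, so `c(χ_p) = ∑_e χ_p(e)² = 4`. -/
theorem normSq_bdry (hL : 2 ≤ L) (p : Plaq d L) : normSq (bdry p) = 4 := by
  obtain ⟨x, ⟨⟨μ, ν⟩, hμν⟩⟩ := p
  have hne : μ ≠ ν := ne_of_lt hμν
  have hab : ((x, μ) : Link d L) ≠ (shift x μ, ν) := fun h => hne (Prod.ext_iff.1 h).2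
  have hac : ((x, μ) : Link d L) ≠ (shift x ν, μ) := fun h => shift_ne hL x ν (Prod.ext_iff.1 h).1.symm
  have had : ((x, μ) : Link d L) ≠ (x, ν) := fun h => hne (Prod.ext_iff.1 h).2
  have hbc : ((shift x μ, ν) : Link d L) ≠ (shift x ν, μ) := fun h => hne (Prod.ext_iff.1 h).2.symm
  have hbd : ((shift x μ, ν) : Link d L) ≠ (x, ν) := fun h => shift_ne hL x μ (Prod.ext_iff.1 h).1
  have hcd : ((shift x ν, μ) : Link d L) ≠ (x, ν) := fun h => hne (Prod.ext_iff.1 h).2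
  have key : ∀ e : Link d L,
      (δ (x, μ) e + δ (shift x μ, ν) e - δ (shift x ν, μ) e - δ (x, ν) e) ^ 2 =
        δ (x, μ) e + δ (shift x μ, ν) e + δ (shift x ν, μ) e + δ (x, ν) e := by
    intro e
    simp only [δ_apply]
    by_cases h1 : e = (x, μ)
    · subst h1
      simp [hab, hac, had]
    by_cases h2 : e = (shift x μ, ν)
    · subst h2
      simp [h1, hbc, hbd]
    by_cases h3 : e = (shift x ν, μ)
    · subst h3
      simp [h1, h2, hcd]
    by_cases h4 : e = (x, ν)
    · subst h4
      simp [h1, h2, h3]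
    · simp [h1, h2, h3, h4]
  unfold normSq
  simp only [bdry, Pi.add_apply, Pi.sub_apply, key, Finset.sum_add_distrib, sum_δ]
  norm_num

variable (d L)

/-- **Lüscher's recursion on the torus, order 0 (OURS).** For `L ≥ 2`:
`Δ s₀ = S + Ċ⁽⁰⁾` with `s₀ = ev (luscherCoeffs (Torus.complex d L) 0)`, `S = ∑_p (1 - cos θ_p)`. -/
theorem lapL_ev_luscherCoeffs_zero (hL : 2 ≤ L) :
    ∃ C : ℝ, ∀ θ : Link d L → ℝ,
      lapL (ev (luscherCoeffs (complex d L) 0)) θ = S1 (complex d L) θ + C :=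
  Abelian.lapL_ev_luscherCoeffs_zero (complex d L) fun p => normSq_bdry hL p

/-- **Lüscher's recursion on the torus, all orders (OURS).** For every `L ≥ 1` and `k`:
`Δ s_{k+1} = -∑_e ∂_e S · ∂_e s_k + Ċ⁽ᵏ⁺¹⁾` with `s_k = ev (luscherCoeffs (Torus.complex d L) k)`; together
with `abs_pd_ev_le_locNorm` and `Torus.locNorm_luscherCoeffs_le_sharp`: for `L ≥ 4`, every `k`, link `e` and
configuration `θ`, `|∂_e s_k(θ)| ≤ ((d-1)/2)·(6(d-1))^k` — the volume-uniform geometric bound on the link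
gradients of LÜSCHER's U(1) functionals themselves (`Torus.abs_pd_luscher_le`). -/
theorem lapL_ev_luscherCoeffs_succ (k : ℕ) :
    ∃ C : ℝ, ∀ θ : Link d L → ℝ,
      lapL (ev (luscherCoeffs (complex d L) (k + 1))) θ =
        -V (complex d L) (ev (luscherCoeffs (complex d L) k)) θ + C :=
  Abelian.lapL_ev_luscherCoeffs_succ (complex d L) k

/-- **THEOREM A for U(1), function side (OURS).** On `(ℤ/L)^d`, `L ≥ 4`: the link derivative of the `k`-th
Lüscher functional obeys `|∂_e s_k(θ)| ≤ ((d-1)/2)·(6(d-1))^k` at every configuration, uniformly in `L`. -/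
theorem abs_pd_luscher_le (hL : 4 ≤ L) (k : ℕ) (e : Link d L) (θ : Link d L → ℝ) :
    |pd e (ev (luscherCoeffs (complex d L) k)) θ| ≤
      ((2 * (d - 1) : ℕ) : ℝ) / 4 * (3 * ((2 * (d - 1) : ℕ) : ℝ)) ^ k :=
  (abs_pd_ev_le_locNorm _ θ e).trans (locNorm_luscherCoeffs_le_sharp d L hL k e)

end TorusDictionary

end Torus

end

end Summit.Ventures.LatticeQCDFlow.TrivializingMaps.Abelian
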